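import Literature.NumberTheory.GelbartRogawski1991.DoubledWeilRepresentationArchVacuum
import Literature.NumberTheory.Weil1964.ArchUnitaryWeilHalfCompact
import Literature.NumberTheory.Automorphic.Liu2021.Def411WeilCarriersCentralTypeRigidity
import Literature.NumberTheory.Automorphic.UnitaryGroupAdelicProduct
import Literature.NumberTheory.Automorphic.UnitaryGroupArchToAdelicPlaces
import Literature.NumberTheory.Automorphic.AdelicSchwartzBruhatDirectSumPure
import HarnessLib

/-!
# The archimedean centre `((t · 1_V) ⊗ 1_W) ⊕ 1` of the doubled unitary group: its vacuum scalars, and the undoubling of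
# the doubled Gaussian ([GelbartRogawski1991, Prop. 3.1.1] by doubling; [Folland1989, Prop. (4.39)]; [KonnoKonno2007, Lem. 5.2])

Topic `NumberTheory/GelbartRogawski1991`; namespace `Literature.NumberTheory.GelbartRogawski1991.GRConstruction`.  KERNEL ONLY:
proved theorems and definitions with bodies (`centerPair`, `centerDiag`, `archK`, `centerDiagC`, `entryD`, `negCount`, `frameV`,
`gaussianV`); 0 records, 0 `def … : Prop`, 0 named facts, 0 `sorry`.  Sequel of `DoubledWeilRepresentationArchHalfExplicit` (`etaD`,
`archHalfOf`), `DoubledWeilRepresentationArchVacuum` (`frameD`, `sectionD`) and `Weil1964/ArchUnitaryWeilHalfCompact`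
(`archUFormPi_eq_kV_of_diagonal`, `exists_proj_archWeilSectionS_eq_realifySp`, `vac_archWeilSectionS_of_kV`).

The central type of a compatible splitting of `G₁(𝔸) = U(V ⊗ W)(𝔸_{L⁺})` is read at the archimedean central elements
`(t · 1_V) ⊗ 1_W`, `t ∈ U(1)(L⁺ ⊗ ℝ)`, on the Gaussian.  For the splitting attached to a character (`chiSplitting χ =
undoubleHom (doubledWeilRep χ)`) this is computed in the DOUBLED group `H = U(𝕍 ⊕ −𝕍)`; this file supplies the bookkeeping:

* § 1 the element: `centerPair u := (u · 1_V) ⊗ 1_W`; the matrix of `((u · 1_V) ⊗ 1_W) ⊕ 1 ∈ H(𝔸)` is `diag(u,…,u,1,…,1)`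
  (`coe_inlG_centerPair`); for the archimedean unit `u = archUnit t = (t, 1)` its finite component is trivial
  (`finPart_inlG_centerPair_archUnit`), so it is the archimedean element **`k_t := archK t ∈ H(L⁺ ⊗ ℝ)`**:
  `archToAdelic (archK t) = ((t · 1_V) ⊗ 1_W) ⊕ 1` (`archToAdelic_archK`), with place components `diag(ι_{w}(t) 1_n, 1_n)`
  (`coe_archAt_archK`);
* § 2 the scalars at `k_t`: `η_τ(k_t) = ∏_v (ι_{w(v)}(t)^n)^{(τ_{w(v)}+1)/2}` (`coe_etaD_archK`); `k_t` is sign-block compact at every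
  place (`archUFormPi_archK`), so Folland's section has a unitary phase map there (`exists_proj_sectionD_archK` — the hypothesis `hu`
  of `omega_archHalfOf_gaussian_tmul`) and vacuum coefficient `vac (sectionD k_t) = (∏_v ι_{w(v)}(t)^{q_v})⁻¹` (`vac_sectionD_archK`),
  `q_v = negCount v` the number of NEGATIVE signs of the pair Gram datum `T_V ⊗ T_W` at `v` (the second copy `−𝕍` carries the entry
  `1` of `k_t`: `prod_negIdx_centerDiagC`);
* § 3 the Gaussian: `frameV` (one copy of `frameD`'s scale function), `gaussianV := h₀ ∘ frameV`, and the UNDOUBLING OF THE VACUUM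
  **`schwartzReindexCLM_archBoxTensor_gaussianV : R_{e₂}(G_𝕍 ⊠ G_𝕍) = h₀ ∘ frameD`** (`√|−x| = √|x|`, `h₀(y ⊕ y′) = h₀(y) h₀(y′)`).

The sequel `Liu2021/Def411WeilCarriersCentralTypeGaussian` assembles these with `doubledWeilRep_archToAdelic_eq_archHalfOf` and
`DoubledWeilRepresentationUndoublingArch` into the central type of `ι_χ` on the Gaussian.  HC_CM is NOT proved here or anywhere in
the tree.  References: S. Gelbart, J. Rogawski, Invent. Math. 105 (1991), §3.1 Prop. 3.1.1 p. 455, Remark p. 457 [GelbartRogawski1991];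
S. Kudla, Israel J. Math. 87 (1994), §2–§3 [Kudla1994]; G. B. Folland, *Harmonic Analysis in Phase Space* (1989), §1.7, §4.2
Prop. (4.39) [Folland1989]; K. Konno, T. Konno, Kyushu J. Math. 61 (2007), §3.1, Lemma 5.2 [KonnoKonno2007]; A. Paul, J. Funct.
Anal. 159 (1998), §1.2 [Paul1998]; A. Borel, H. Jacquet, PSPM 33.1 (1979), §4.1 [BorelJacquet1979]; M. Harris, S. Kudla, W. J. Sweet,
J. AMS 9 (1996), §1 (1.9) [HarrisKudlaSweet1996].  Provenance: pub-hodgecm2 (COR-CM) cell, seat pin-3 (gen 9), X3-Char item (E) = (E1).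
-/

set_option autoImplicit false

noncomputable section

open scoped Classical
open scoped Matrix Kronecker TensorProduct SchwartzMap
open NumberField NumberField.InfinitePlace NumberField.mixedEmbedding IsDedekindDomain
open Literature.RepresentationTheory.HeisenbergGroup
open Literature.NumberTheory.Automorphic
open Literature.NumberTheory.Weil1964
open Literature.RepresentationTheory.HarrisKudlaSweet1996
open Literature.NumberTheory.GaloisRepresentations
open Literature.Analysis.SegalBargmann

namespace Literature.NumberTheory.GelbartRogawski1991.GRConstruction

open UnitaryDualPair UnitaryDualPair.ArchSplitting
open Literature.NumberTheory.GelbartRogawski1991.UnitaryDualPair.LocalSplitting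
open Literature.NumberTheory.Automorphic.Liu2021.Def411WeilCarriersDoubling (archUnit coe_archUnit)

variable (L : Type) [Field L] [NumberField L] [IsCMField L]

variable {N M n : ℕ} (e : Fin N × Fin M ≃ Fin n)
  (dV : Fin N → L) (hdV : ∀ i, IsCMField.complexConj L (dV i) = dV i) (hdV0 : ∀ i, dV i ≠ 0)
  (dW : Fin M → L) (hdW : ∀ i, IsCMField.complexConj L (dW i) = dW i) (hdW0 : ∀ i, dW i ≠ 0)

/-! ## §1 The element `((u · 1_V) ⊗ 1_W) ⊕ 1` and its archimedean avatar `k_t` -/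

section CenterElement

/-- the adelic pair-group element `(u · 1_V) ⊗ 1_W ∈ G₁(𝔸)` of a norm-one idele class unit `u ∈ U(1)(𝔸_{L⁺})`
(`adelicInl ∘ CMCenter`). [cite: GelbartRogawski1991, §3.1 Remark p. 457 L9–13] -/
abbrev centerPair (u : CMAdelicOne L) :
    UnitaryGroup.adelicPair (Fp L) L (IsCMField.complexConj L) N M (Matrix.diagonal dV) (Matrix.diagonal dW) :=
  UnitaryGroup.adelicInl (Fp L) L (IsCMField.complexConj L) N M (Matrix.diagonal dV) (Matrix.diagonal dW) (CMCenter L dV u)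

/-- the diagonal entry family of `(u · 1_𝕍) ⊕ 1_{−𝕍}` in the enumeration `e₂` of `𝔻 = 𝕍 ⊕ 𝕍`: `u` on the first copy, `1` on the
second. [cite: Kudla1994, §2 (doubled space, Siegel parabolic)] -/
def centerDiag (u : AdeleRing (𝓞 L) L) (k : Fin (n + n)) : AdeleRing (𝓞 L) L :=
  Sum.elim (fun _ : Fin n => u) (fun _ : Fin n => 1) ((e₂ (n := n)).symm k)

/-- **the matrix of `((u · 1_V) ⊗ 1_W) ⊕ 1 ∈ H(𝔸)`** is the diagonal matrix `diag(u,…,u,1,…,1)` (in the enumeration `e₂`).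
[cite: Kudla1994, §2 (doubled space, Siegel parabolic)] -/
theorem coe_inlG_centerPair (u : CMAdelicOne L) :
    (((inlG L e dV hdV dW hdW (centerPair L dV dW u) : HA L e dV hdV dW hdW) : GL (Fin (n + n)) (AdeleRing (𝓞 L) L)) :
        Matrix (Fin (n + n)) (Fin (n + n)) (AdeleRing (𝓞 L) L)) =
      Matrix.diagonal (centerDiag L (n := n) (((u : CMAdelicOne L) : ideleGroup L) : AdeleRing (𝓞 L) L)) := by
  rw [coe_inlG, UnitaryGroup.coe_reindexGL, UnitaryGroup.coe_blockDiagGL, UnitaryGroup.coe_reindexGL, UnitaryGroup.coe_adelicInl,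
    UnitaryGroup.coe_adelicCenter, Matrix.smul_kronecker, Matrix.one_kronecker_one, Units.val_one,
    Matrix.smul_one_eq_diagonal]
  rw [show Matrix.reindex e e (Matrix.diagonal fun _ : Fin N × Fin M => (((u : CMAdelicOne L) : ideleGroup L) : AdeleRing (𝓞 L) L)) =
      Matrix.diagonal fun _ : Fin n => (((u : CMAdelicOne L) : ideleGroup L) : AdeleRing (𝓞 L) L) from by
    rw [Matrix.reindex_apply, Matrix.submatrix_diagonal_equiv]; rfl]
  rw [← Matrix.diagonal_one, Matrix.fromBlocks_diagonal, Matrix.reindex_apply, Matrix.submatrix_diagonal_equiv]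
  rfl

omit [IsCMField L] in
/-- the entries of `centerDiag u` are `u` or `1`. [cite: Kudla1994, §2 (doubled space, Siegel parabolic)] -/
theorem centerDiag_eq_or (u : AdeleRing (𝓞 L) L) (k : Fin (n + n)) :
    centerDiag L (n := n) u k = u ∨ centerDiag L (n := n) u k = 1 := by
  unfold centerDiag
  rcases (e₂ (n := n)).symm k with i | i
  · exact Or.inl rfl
  · exact Or.inr rfl

omit [IsCMField L] in
/-- a map fixing `1` passes through `centerDiag`: `f (centerDiag u k) = centerDiag' (f u) k` — stated for the two readings used
below (finite component; complex coordinate). [cite: Kudla1994, §2 (doubled space, Siegel parabolic)] -/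
theorem apply_centerDiag {S : Type*} [One S] (f : AdeleRing (𝓞 L) L → S) (hf : f 1 = 1) (u : AdeleRing (𝓞 L) L) (k : Fin (n + n)) :
    f (centerDiag L (n := n) u k) = Sum.elim (fun _ : Fin n => f u) (fun _ : Fin n => 1) ((e₂ (n := n)).symm k) := by
  unfold centerDiag
  rcases (e₂ (n := n)).symm k with i | i
  · rfl
  · exact hf

/-- **the finite component of `((t · 1_V) ⊗ 1_W) ⊕ 1` is trivial** for an ARCHIMEDEAN norm-one unit `t ∈ U(1)(L⁺ ⊗ ℝ)` (the idele
`archUnit t = (t, 1)`). [cite: BorelJacquet1979, §4.1] -/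
theorem finPart_inlG_centerPair_archUnit (t : relNormOneInfUnits (Fp L) L) :
    UnitaryGroup.finPart (Fp L) L (IsCMField.complexConj L) (n + n) (hermD L e dV hdV dW hdW)
        (inlG L e dV hdV dW hdW (centerPair L dV dW (archUnit L t))) = 1 := by
  apply Subtype.ext
  refine Matrix.GeneralLinearGroup.ext fun i j => ?_
  change ((((inlG L e dV hdV dW hdW (centerPair L dV dW (archUnit L t)) : HA L e dV hdV dW hdW) :
      GL (Fin (n + n)) (AdeleRing (𝓞 L) L)) : Matrix (Fin (n + n)) (Fin (n + n)) (AdeleRing (𝓞 L) L)) i j).2 =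
    ((1 : GL (Fin (n + n)) (FiniteAdeleRing (𝓞 L) L)) : Matrix (Fin (n + n)) (Fin (n + n)) (FiniteAdeleRing (𝓞 L) L)) i j
  rw [coe_inlG_centerPair, Matrix.diagonal_apply, Units.val_one, Matrix.one_apply]
  split_ifs with h
  · rcases centerDiag_eq_or L (n := n) ((((archUnit L t : CMAdelicOne L) : ideleGroup L) : AdeleRing (𝓞 L) L)) i with h1 | h1
    · rw [h1]; rfl
    · rw [h1]; rfl
  · rfl

/-- **the archimedean element `k_t := (((t · 1_V) ⊗ 1_W) ⊕ 1)_∞ ∈ H(L⁺ ⊗ ℝ) = U(J^𝔻)(L ⊗ ℝ)`** at which the central type of the undoubled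
splitting is read: the archimedean component (`archPart`) of `((t · 1_V) ⊗ 1_W) ⊕ 1 ∈ H(𝔸)`. [cite: BorelJacquet1979, §4.1]
[cite: Kudla1994, §2 (doubled space, Siegel parabolic)] -/
def archK (t : relNormOneInfUnits (Fp L) L) :
    UnitaryGroup.arch (Fp L) L (IsCMField.complexConj L) (n + n) (hermD L e dV hdV dW hdW) :=
  UnitaryGroup.archPart (Fp L) L (IsCMField.complexConj L) (n + n) (hermD L e dV hdV dW hdW)
    (inlG L e dV hdV dW hdW (centerPair L dV dW (archUnit L t)))

/-- **`(k_t, 1) = ((t · 1_V) ⊗ 1_W) ⊕ 1` in `H(𝔸)`**: the element is archimedean (`g = (g_∞, 1) · (1, g_f)` with `g_f = 1`).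
[cite: BorelJacquet1979, §4.1] -/
theorem archToAdelic_archK (t : relNormOneInfUnits (Fp L) L) :
    UnitaryGroup.archToAdelic (Fp L) L (IsCMField.complexConj L) (n + n) (hermD L e dV hdV dW hdW) (archK L e dV hdV dW hdW t) =
      inlG L e dV hdV dW hdW (centerPair L dV dW (archUnit L t)) := by
  have h := UnitaryGroup.archToAdelic_mul_finAdelicToAdelic (Fp L) L (IsCMField.complexConj L) (n + n) (hermD L e dV hdV dW hdW)
    (inlG L e dV hdV dW hdW (centerPair L dV dW (archUnit L t)))
  rw [finPart_inlG_centerPair_archUnit, map_one, mul_one] at h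
  exact h

/-- **the place components of `k_t` are the diagonal matrices `diag(ι_w(t),…,ι_w(t),1,…,1)`** (`w = w(v)` the complex place over the
real place `v`; enumeration `e₂`). [cite: BorelJacquet1979, §4.1] [cite: Kudla1994, §2 (doubled space, Siegel parabolic)] -/
theorem coe_archAt_archK (t : relNormOneInfUnits (Fp L) L) (v : {v : InfinitePlace (Fp L) // v.IsReal}) :
    (((UnitaryGroup.archAt (Fp L) L (IsCMField.complexConj L) (n + n) (hermD L e dV hdV dW hdW) (cmPlaceOver L v) (cmPlaceOver_smul L v)
        (IsCMField.complexConj_ne_one L) (archK L e dV hdV dW hdW t) :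
        UnitaryGroup.archLocal L (n + n) (hermD L e dV hdV dW hdW) (cmPlaceOver L v)) : GL (Fin (n + n)) ℂ) :
        Matrix (Fin (n + n)) (Fin (n + n)) ℂ) =
      Matrix.diagonal fun k => Sum.elim (fun _ : Fin n => ((archPlaceChar L (cmPlaceOver L v).1 t : Circle) : ℂ)) (fun _ : Fin n => 1)
        ((e₂ (n := n)).symm k) := by
  rw [← UnitaryGroup.map_placeEval_coe_archToAdelic, archToAdelic_archK]
  change ((((inlG L e dV hdV dW hdW (centerPair L dV dW (archUnit L t)) : HA L e dV hdV dW hdW) :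
      GL (Fin (n + n)) (AdeleRing (𝓞 L) L)) : Matrix (Fin (n + n)) (Fin (n + n)) (AdeleRing (𝓞 L) L))).map _ = _
  rw [coe_inlG_centerPair, Matrix.diagonal_map (map_zero _)]
  congr 1
  funext k
  exact (apply_centerDiag L (n := n) _ (map_one _) _ k).trans rfl

end CenterElement

/-! ## §2 The scalars at `k_t`: `η_τ(k_t)`, the unitary phase map, `vac (sectionD k_t)` -/

section Scalars

open Literature.RepresentationTheory.KonnoKonno2007 Literature.RepresentationTheory.KonnoKonno2007.RealDualPair
open Literature.NumberTheory.Weil1964.UnitaryBall (d)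
open Literature.Analysis.SegalBargmann

/-- the complex diagonal entries of the place component of `k_t` at `v`: `ι_{w(v)}(t)` on the first copy, `1` on the second.
[cite: Kudla1994, §2 (doubled space, Siegel parabolic)] -/
def centerDiagC (t : relNormOneInfUnits (Fp L) L) (v : {v : InfinitePlace (Fp L) // v.IsReal}) (k : Fin (n + n)) : ℂ :=
  Sum.elim (fun _ : Fin n => ((archPlaceChar L (cmPlaceOver L v).1 t : Circle) : ℂ)) (fun _ : Fin n => 1) ((e₂ (n := n)).symm k)

/-- the entries of `centerDiagC` have modulus one. [cite: BrockerTomDieck1985, IV (3.1)] -/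
theorem norm_centerDiagC (t : relNormOneInfUnits (Fp L) L) (v : {v : InfinitePlace (Fp L) // v.IsReal}) (k : Fin (n + n)) :
    ‖centerDiagC L (n := n) t v k‖ = 1 := by
  unfold centerDiagC
  rcases (e₂ (n := n)).symm k with i | i
  · exact Circle.norm_coe _
  · exact norm_one

/-- `∏_k centerDiagC t v k = ι_{w(v)}(t) ^ n`. [cite: BrockerTomDieck1985, IV (3.1)] -/
theorem prod_centerDiagC (t : relNormOneInfUnits (Fp L) L) (v : {v : InfinitePlace (Fp L) // v.IsReal}) :
    ∏ k, centerDiagC L (n := n) t v k = ((archPlaceChar L (cmPlaceOver L v).1 t : Circle) : ℂ) ^ n := by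
  unfold centerDiagC
  rw [← Equiv.prod_comp (e₂ (n := n))]
  simp only [Equiv.symm_apply_apply, Fintype.prod_sum_type, Sum.elim_inl, Sum.elim_inr, Finset.prod_const,
    Finset.card_univ, Fintype.card_fin, one_pow, mul_one]

/-- **`η_τ(k_t) = ∏_v ι_{w(v)}(t)^{n (τ_{w(v)}+1)/2}`**: the explicit twist character of the doubled group at `k_t`
(`det (k_t)_{w} = ι_w(t)^n`). [cite: Paul1998, §1.2 (1.2.1)–(1.2.2) p. 389 L11–29] -/
theorem coe_etaD_archK (τ : InfinitePlace L → ℤ) (t : relNormOneInfUnits (Fp L) L) :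
    ((etaD L e dV hdV dW hdW τ (archK L e dV hdV dW hdW t) : ℂˣ) : ℂ) =
      ∏ v : {v : InfinitePlace (Fp L) // v.IsReal},
        (((archPlaceChar L (cmPlaceOver L v).1 t : Circle) : ℂ) ^ n) ^ ((τ (cmPlaceOver L v).1 + 1) / 2) := by
  rw [etaD, UnitaryGroup.coe_archDetZPow]
  refine Finset.prod_congr rfl fun v _ => ?_
  rw [coe_archAt_archK, Matrix.det_diagonal]
  exact congrArg (fun z : ℂ => z ^ ((τ (cmPlaceOver L v).1 + 1) / 2)) (prod_centerDiagC L (n := n) t v)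

/-- the doubled sign datum `t₀^𝔻 : Fin (n + n) → L⁺` of `frameD` ∕ `sectionD` (entries `t₀` on the first copy, `−t₀` on the second).
[cite: HarrisKudlaSweet1996, §1 (1.9)] -/
abbrev entryD : Fin (n + n) → Fp L := fun k =>
  Sum.elim (cmGramEntry L e dV hdV dW hdW) (-cmGramEntry L e dV hdV dW hdW) ((LocalSplitting.e₂ n).symm k)

/-- **the place components of `k_t` are sign-block compact** (diagonal, `A4`): `archUFormPi (k_t) v = kV (diag, diag)`.
[cite: Folland1989, §4.2 Prop. (4.39)] [cite: KonnoKonno2007, §3.1] -/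
theorem archUFormPi_archK (t : relNormOneInfUnits (Fp L) L) (v : {v : InfinitePlace (Fp L) // v.IsReal}) :
    archUFormPi L (IsCMField.complexConj L) (n + n) (IsCMField.complexConj_ne_one L) (cmPlaceOver L) (cmPlaceOver_smul L)
        (cmPlaceOver_comap L) (entryD L e dV hdV dW hdW) (gramD_gram_realDiagonal_entry_ne_zero L e dV hdV dW hdW hdV0 hdW0)
        (gramD_eq_diagonal_cm L e dV hdV dW hdW) (J := hermD L e dV hdV dW hdW) rfl (complexConj_imagUnit L) (imagUnit_ne_zero L)
        (archK L e dV hdV dW hdW t) v =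
      UForm.kV _ _
        (diagUnitary (fun p : PosIdx (signVec (cmPlaceOver L) (entryD L e dV hdV dW hdW) (imagUnit L) v) =>
            centerDiagC L (n := n) t v ((signSplit (signVec (cmPlaceOver L) (entryD L e dV hdV dW hdW) (imagUnit L) v)).symm (Sum.inl p)))
          (fun _ => norm_centerDiagC L t v _),
         diagUnitary (fun q : NegIdx (signVec (cmPlaceOver L) (entryD L e dV hdV dW hdW) (imagUnit L) v) =>
            centerDiagC L (n := n) t v ((signSplit (signVec (cmPlaceOver L) (entryD L e dV hdV dW hdW) (imagUnit L) v)).symm (Sum.inr q)))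
          (fun _ => norm_centerDiagC L t v _)) :=
  archUFormPi_eq_kV_of_diagonal L (IsCMField.complexConj L) (n + n) (IsCMField.complexConj_ne_one L) (cmPlaceOver L)
    (cmPlaceOver_smul L) (cmPlaceOver_comap L) (entryD L e dV hdV dW hdW)
    (gramD_gram_realDiagonal_entry_ne_zero L e dV hdV dW hdW hdV0 hdW0) (gramD_eq_diagonal_cm L e dV hdV dW hdW) rfl
    (complexConj_imagUnit L) (imagUnit_ne_zero L) (archK L e dV hdV dW hdW t) v (centerDiagC L (n := n) t v)
    (norm_centerDiagC L t v) (coe_archAt_archK L e dV hdV dW hdW t v)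

/-- **the phase map of Folland's section at `k_t` is a realified unitary** — the hypothesis `hu` of `omega_archHalfOf_gaussian_tmul`.
[cite: Folland1989, §4.2 Prop. (4.39)] -/
theorem exists_proj_sectionD_archK (t : relNormOneInfUnits (Fp L) L) :
    ∃ u : Matrix.unitaryGroup (Fin (n + n) × {v : InfinitePlace (Fp L) // v.IsReal}) ℂ,
      MpS.proj (sectionD L e dV hdV hdV0 dW hdW hdW0 (archK L e dV hdV dW hdW t)) = realifySp _ u :=
  exists_proj_archWeilSectionS_eq_realifySp L (IsCMField.complexConj L) (n + n) (IsCMField.complexConj_ne_one L) (cmPlaceOver L)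
    (cmPlaceOver_smul L) (cmPlaceOver_comap L) (entryD L e dV hdV dW hdW)
    (gramD_gram_realDiagonal_entry_ne_zero L e dV hdV dW hdW hdV0 hdW0) (gramD_eq_diagonal_cm L e dV hdV dW hdW) rfl
    (complexConj_imagUnit L) (imagUnit_ne_zero L) (archK L e dV hdV dW hdW t) _ _ (archUFormPi_archK L e dV hdV hdV0 dW hdW hdW0 t)

/-- **the number of NEGATIVE signs of the pair Gram datum `T_V ⊗ T_W` at the real place `v`** (`q_v`, the size of the negative sign block
of `𝕎_v = (V ⊗ W)_v` in the canonical sign frame). [cite: KonnoKonno2007, §3.1] -/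
def negCount (v : {v : InfinitePlace (Fp L) // v.IsReal}) : ℕ :=
  Fintype.card (NegIdx (signVec (cmPlaceOver L) (cmGramEntry L e dV hdV dW hdW) (imagUnit L) v))

/-- the doubled sign vector on the first copy is the sign vector of the pair datum. [cite: HarrisKudlaSweet1996, §1 (1.9)] -/
theorem signVec_entryD_inl (v : {v : InfinitePlace (Fp L) // v.IsReal}) (i : Fin n) :
    signVec (cmPlaceOver L) (entryD L e dV hdV dW hdW) (imagUnit L) v ((e₂ (n := n)) (Sum.inl i)) =
      signVec (cmPlaceOver L) (cmGramEntry L e dV hdV dW hdW) (imagUnit L) v i := by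
  simp only [signVec, placeSignVec, entryD, Equiv.symm_apply_apply, Sum.elim_inl]

/-- **`∏_{q ∈ Q_v^𝔻} (k_t)_q = ι_{w(v)}(t)^{q_v}`**: on the negative sign block of the DOUBLED datum at `v`, the diagonal entries of `k_t`
multiply to `ι_{w(v)}(t)` to the number of negative signs of the ORIGINAL pair datum (the second copy carries the entry `1`).
[cite: KonnoKonno2007, §3.1, Lemma 5.2 p. 73] -/
theorem prod_negIdx_centerDiagC (t : relNormOneInfUnits (Fp L) L) (v : {v : InfinitePlace (Fp L) // v.IsReal}) :
    ∏ q : NegIdx (signVec (cmPlaceOver L) (entryD L e dV hdV dW hdW) (imagUnit L) v),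
        centerDiagC L (n := n) t v
          ((signSplit (signVec (cmPlaceOver L) (entryD L e dV hdV dW hdW) (imagUnit L) v)).symm (Sum.inr q)) =
      ((archPlaceChar L (cmPlaceOver L v).1 t : Circle) : ℂ) ^ negCount L e dV hdV dW hdW v := by
  set x := signVec (cmPlaceOver L) (entryD L e dV hdV dW hdW) (imagUnit L) v with hx
  have h1 : ∀ q : NegIdx x, (signSplit x).symm (Sum.inr q) = q.1 := fun q => rfl
  simp only [h1]
  rw [← Finset.prod_subtype (Finset.univ.filter fun k : Fin (n + n) => ¬0 < x k) (by simp), Finset.prod_filter,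
    ← Equiv.prod_comp (e₂ (n := n)), Fintype.prod_sum_type]
  have hl : ∀ i : Fin n, centerDiagC L (n := n) t v ((e₂ (n := n)) (Sum.inl i)) =
      ((archPlaceChar L (cmPlaceOver L v).1 t : Circle) : ℂ) := fun i => by
    simp only [centerDiagC, Equiv.symm_apply_apply, Sum.elim_inl]
  have hr : ∀ i : Fin n, centerDiagC L (n := n) t v ((e₂ (n := n)) (Sum.inr i)) = 1 := fun i => by
    simp only [centerDiagC, Equiv.symm_apply_apply, Sum.elim_inr]
  simp only [hl, hr, ite_self, Finset.prod_const_one, mul_one]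
  rw [← Finset.prod_filter, Finset.prod_const, negCount, Fintype.card_subtype]
  congr 2
  ext i
  simp only [Finset.mem_filter, Finset.mem_univ, true_and, hx, signVec_entryD_inl]

/-- **the vacuum coefficient of Folland's section at `k_t`**: `vac (sectionD k_t) = (∏_v ι_{w(v)}(t)^{q_v})⁻¹` — the determinant of the
negative sign block of `k_t ⊗ 1` (`vac_archWeilSectionS`, `placeDiag_kV`, `det_d_toBig_κ`). [cite: Folland1989, §4.2 Prop. (4.39)]
[cite: KonnoKonno2007, Lemma 5.2 p. 73] -/
theorem vac_sectionD_archK (t : relNormOneInfUnits (Fp L) L) :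
    MpS.vac (sectionD L e dV hdV hdV0 dW hdW hdW0 (archK L e dV hdV dW hdW t)) =
      (∏ v : {v : InfinitePlace (Fp L) // v.IsReal},
        ((archPlaceChar L (cmPlaceOver L v).1 t : Circle) : ℂ) ^ negCount L e dV hdV dW hdW v)⁻¹ := by
  rw [show MpS.vac (sectionD L e dV hdV hdV0 dW hdW hdW0 (archK L e dV hdV dW hdW t)) = _ from
    vac_archWeilSectionS_of_kV L (IsCMField.complexConj L) (n + n) (IsCMField.complexConj_ne_one L) (cmPlaceOver L)
      (cmPlaceOver_smul L) (cmPlaceOver_comap L) (entryD L e dV hdV dW hdW)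
      (gramD_gram_realDiagonal_entry_ne_zero L e dV hdV dW hdW hdV0 hdW0) (gramD_eq_diagonal_cm L e dV hdV dW hdW)
      (J := hermD L e dV hdV dW hdW) rfl (complexConj_imagUnit L) (imagUnit_ne_zero L) (archK L e dV hdV dW hdW t) _ _
      (archUFormPi_archK L e dV hdV hdV0 dW hdW hdW0 t)]
  congr 1
  refine Finset.prod_congr rfl fun v _ => ?_
  rw [coe_diagUnitary, Matrix.det_diagonal]
  exact prod_negIdx_centerDiagC L e dV hdV dW hdW t v

end Scalars

/-! ## §3 The Gaussian of one copy and the undoubling of the doubled Gaussian -/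

section Gaussian

/-- **the scaled Folland frame of ONE copy `𝕎 = V ⊗ W`** of the doubled space, in the `cmPlaceOver` sign conventions — the first
half of the scale function of `frameD` (scales `√|x_v(j)|`, `x_v` the sign vector of the pair Gram datum `T_V ⊗ T_W` at `v`).
[cite: Folland1989, §1.3 (1.25), §4.2 Prop. (4.39)] -/
abbrev frameV : ((Fin n) → mixedSpace (Fp L)) ≃L[ℝ] ((Fin n) × {v : InfinitePlace (Fp L) // v.IsReal} → ℝ) :=
  scaledFrame (Fp L) (Fin n)
    (placeScale n fun v => sqrtAbs (signVec (cmPlaceOver L) (cmGramEntry L e dV hdV dW hdW) (imagUnit L) v))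
    (placeScale_ne_zero n (sqrtAbs_signVec_ne_zero (IsCMField.complexConj_ne_one L) (cmPlaceOver_smul L)
      (complexConj_imagUnit L) (imagUnit_ne_zero L) (cmGramEntry_ne_zero L e dV hdV dW hdW hdV0 hdW0)))

/-- **the archimedean GAUSSIAN of the pair `(V, W)`**: the Folland–Fock vacuum `h₀ ∘ frameV` of `𝓢((L⁺ ⊗ ℝ)^n)`.
[cite: Folland1989, §1.7, §4.2 Prop. (4.39)] -/
def gaussianV : 𝓢((Fin n → mixedSpace (Fp L)), ℂ) := follandHermite (frameV L e dV hdV hdV0 dW hdW hdW0) 0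

/-- the Gaussian is non-zero. [cite: Folland1989, §1.7] -/
theorem gaussianV_ne_zero : gaussianV L e dV hdV hdV0 dW hdW hdW0 ≠ 0 := fun h =>
  hermitePi_zero_ne_zero (σ := (Fin n) × {v : InfinitePlace (Fp L) // v.IsReal})
    (((schwartzTransport (frameV L e dV hdV hdV0 dW hdW hdW0)).symm.map_eq_zero_iff).1 h)

/-- the doubled sign vector on the second copy is MINUS the sign vector of the pair datum. [cite: HarrisKudlaSweet1996, §1 (1.9)] -/
theorem signVec_doubled_inr (v : {v : InfinitePlace (Fp L) // v.IsReal}) (i : Fin n) :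
    signVec (cmPlaceOver L)
        (fun k => Sum.elim (cmGramEntry L e dV hdV dW hdW) (-cmGramEntry L e dV hdV dW hdW) ((LocalSplitting.e₂ n).symm k))
        (imagUnit L) v ((e₂ (n := n)) (Sum.inr i)) =
      -signVec (cmPlaceOver L) (cmGramEntry L e dV hdV dW hdW) (imagUnit L) v i := by
  simp only [signVec, placeSignVec, Equiv.symm_apply_apply, Sum.elim_inr, Pi.neg_apply, map_neg, neg_div]

/-- the doubled sign vector on the first copy is the sign vector of the pair datum. [cite: HarrisKudlaSweet1996, §1 (1.9)] -/
theorem signVec_doubled_inl (v : {v : InfinitePlace (Fp L) // v.IsReal}) (i : Fin n) :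
    signVec (cmPlaceOver L)
        (fun k => Sum.elim (cmGramEntry L e dV hdV dW hdW) (-cmGramEntry L e dV hdV dW hdW) ((LocalSplitting.e₂ n).symm k))
        (imagUnit L) v ((e₂ (n := n)) (Sum.inl i)) =
      signVec (cmPlaceOver L) (cmGramEntry L e dV hdV dW hdW) (imagUnit L) v i := by
  simp only [signVec, placeSignVec, Equiv.symm_apply_apply, Sum.elim_inl]

/-- **THE DOUBLED GAUSSIAN IS THE PRODUCT OF THE TWO HALF GAUSSIANS**: `R_{e₂}(G_𝕍 ⊠ G_𝕍) = G^𝔻 = h₀ ∘ frameD` — the scale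
function of `frameD` is `√|±x_v(j)| = √|x_v(j)|` on both copies, and `h₀(y ⊕ y′) = h₀(y) h₀(y′)`.
[cite: Folland1989, §1.7, §4.2 Prop. (4.39)] [cite: HarrisKudlaSweet1996, §1 (1.9)] -/
theorem schwartzReindexCLM_archBoxTensor_gaussianV :
    schwartzReindexCLM (Fp L) (e₂ (n := n)) (archBoxTensor (gaussianV L e dV hdV hdV0 dW hdW hdW0) (gaussianV L e dV hdV hdV0 dW hdW hdW0)) =
      follandHermite (frameD L e dV hdV hdV0 dW hdW hdW0) 0 := by
  ext x
  rw [schwartzReindexCLM_apply, archBoxTensor_apply]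
  simp only [gaussianV, follandHermite, schwartzTransport_symm_apply, hermitePi_apply, herm_zero, hermiteFun, vac,
    MvPolynomial.eval_C, gauss]
  -- constants and exponents
  have hc : ((vacCoef (Fin n × {v : InfinitePlace (Fp L) // v.IsReal}) : ℝ) : ℂ) *
      ((vacCoef (Fin n × {v : InfinitePlace (Fp L) // v.IsReal}) : ℝ) : ℂ) =
      ((vacCoef (Fin (n + n) × {v : InfinitePlace (Fp L) // v.IsReal}) : ℝ) : ℂ) := by
    rw [← Complex.ofReal_mul, vacCoef, vacCoef, ← Real.rpow_add (by norm_num : (0 : ℝ) < 2)]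
    congr 2
    simp only [Fintype.card_prod, Fintype.card_fin]
    push_cast
    ring
  rw [mul_mul_mul_comm, hc, ← Complex.exp_add]
  congr 2
  rw [← mul_add]
  congr 1
  -- the quadratic forms agree term by term after reindexing the doubled sum along `e₂ × id`
  symm
  rw [← Fintype.sum_equiv ((e₂ (n := n)).prodCongr (Equiv.refl _))
    (fun s => (((frameD L e dV hdV hdV0 dW hdW hdW0) x (((e₂ (n := n)).prodCongr (Equiv.refl _)) s) : ℝ) : ℂ) ^ 2) _
    (fun _ => rfl)]
  simp only [Fintype.sum_prod_type, Fintype.sum_sum_type]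
  congr 1
  · refine Finset.sum_congr rfl fun i _ => Finset.sum_congr rfl fun v _ => ?_
    congr 2
    simp only [Equiv.prodCongr_apply, Prod.map, Equiv.coe_refl, id, scaledFrame_apply, placeScale, Function.comp_apply,
      sqrtAbs, signVec_doubled_inl]
  · refine Finset.sum_congr rfl fun i _ => Finset.sum_congr rfl fun v _ => ?_
    congr 2
    simp only [Equiv.prodCongr_apply, Prod.map, Equiv.coe_refl, id, scaledFrame_apply, placeScale, Function.comp_apply,
      sqrtAbs, signVec_doubled_inr, abs_neg]

end Gaussian

end Literature.NumberTheory.GelbartRogawski1991.GRConstruction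

end
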